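import Literature.AnabelianGeometry.SemiGraphs.SpecialFibreTowerOfCoveringsFiniteVertices
import Literature.AnabelianGeometry.SemiGraphs.ChartFiniteObjects
import HarnessLib

/-!
# [SemiAnbd] Example 3.10: the fibres `𝒢_i` of the special-fibre tower over `π₁^temp(𝒢)` of a FINITE `𝒢` are
# FINITE coverings — finitely many vertices AND finitely many edges

Mochizuki, *Semi-graphs of anabelioids*, Publ. RIMS **42** (2006), §3, Example 3.10, manuscript p. 44
[cite: MochizukiSemiAnbd2006, Ex 3.10 p.44] (the `𝒢_i` are the semi-graphs of anabelioids of FINITE étale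
coverings — finite semi-graphs, with finitely many cusps); Def. 3.5 (i) p. 37 (the covering `G_S → G`: vertices and
edges of `G_S` over `v`, `e` are the `Π_v`-orbits of `S_v`, the `Π_e`-orbits of `S_e`); §3 p. 37 ("finite" objects
of `B^cov(G)`).

PROOF-ONLY sequel (abc-iut cell, layer L3, seat abc-iut-L3-t2 gen 5, row «Ex310-GRAPH-ACTION», part F) of
`SpecialFibreTower.exists_of_coverings_finite_vertex`.  Three elementary bricks and one corollary:
* `BTemp.finite_of_finite_orbits` — an object of `B^temp(Π)`, `Π` COMPACT, with finitely many orbits has finitely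
  many points (an orbit is `Π/Stab`, stabilisers are open, open subgroups of compact groups have finite index);
* `CovObj.isFinite_of_finite_vertex_coveringGraph` — over a connected `𝒢` with a vertex, an object `S` of
  `B^cov(G)` whose covering semi-graph `𝔾_S` has finitely many vertices is a FINITE object (one finite `S_v`
  suffices, abc-iut-L3's `CovObj.isFinite_of_finite_SV`);
* `CovObj.finite_edge_coveringGraph` / `CovObj.finite_vertex_coveringGraph` — a finite object over a finite `𝒢`
  has a covering semi-graph with finitely many edges / vertices;
* `SpecialFibreTower.exists_of_coverings_finite` — for a FINITE coherent Thm-3.7 `𝒢`, the tower of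
  `exists_of_coverings_finite_vertex` (levels `N`, fibres `𝒢_{S_i}`, admissible kernels `1`) has, at every level,
  `S_i` a FINITE connected tempered covering and `𝔾_i` with finitely many vertices and finitely many EDGES — both
  halves of the field `FiniteLevels` of the origin record `SpecialFibreTower.PiData` at the genuine fibres (the edge
  half is new; it uses no edge dictionary and no commensurable-rigidity hypothesis).
No definition; nothing about curves; no side is taken on [IUTchIII] Cor. 3.12.
-/

noncomputable section

open CategoryTheory Topology

namespace Literature.AnabelianGeometry.SemiGraphs

open Literature.AlgebraicGeometry.Frobenioids (IsConnectedObj)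
open Literature.AlgebraicGeometry.Frobenioids.QuasiTemperoid.BTempConnected (ρ_mul_apply)
open ProfiniteSemiGraph

universe u

/-! ### Finitely many orbits under a compact group ⇒ finitely many points -/

namespace BTemp

/-- **An object of `B^temp(Π)` over a COMPACT `Π` with finitely many orbits has finitely many points**: the orbit
of `s` is the image of `Π/Stab(s)`, and `Stab(s)` is open, hence of finite index in the compact group `Π`.
[cite: MochizukiSemiAnbd2006, §3 p.37] -/
theorem finite_of_finite_orbits {G : Type u} [Group G] [TopologicalSpace G] [IsTopologicalGroup G]
    [CompactSpace G] (X : BTemp G) [Finite (BTemp.Orbits X)] : Finite X.obj.V := by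
  classical
  haveI : ∀ ω : BTemp.Orbits X, Finite (G ⧸ BTemp.stab X (Quot.out ω)) := fun ω =>
    Subgroup.quotient_finite_of_isOpen _ (X.property.2 (Quot.out ω))
  refine Finite.of_surjective
    (fun p : Σ ω : BTemp.Orbits X, G ⧸ BTemp.stab X (Quot.out ω) => X.obj.ρ p.2.out (Quot.out p.1)) ?_
  intro x
  obtain ⟨g, hg⟩ := (BTemp.cl_eq_cl_iff X (Quot.out (BTemp.cl X x)) x).mp (Quot.out_eq _)
  obtain ⟨h, hh⟩ := QuotientGroup.mk_out_eq_mul (BTemp.stab X (Quot.out (BTemp.cl X x))) g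
  refine ⟨⟨BTemp.cl X x, (g : G ⧸ BTemp.stab X (Quot.out (BTemp.cl X x)))⟩, ?_⟩
  change X.obj.ρ (Quotient.out (g : G ⧸ BTemp.stab X (Quot.out (BTemp.cl X x)))) (Quot.out (BTemp.cl X x)) = x
  rw [hh, ρ_mul_apply, show X.obj.ρ (h : G) (Quot.out (BTemp.cl X x)) = Quot.out (BTemp.cl X x) from h.2, hg]

end BTemp

/-! ### Finite objects of `B^cov(G)` and their covering semi-graphs -/

namespace ProfiniteSemiGraph

namespace CovObj

variable {𝒢 : ProfiniteSemiGraph.{u}} (S : CovObj 𝒢)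

/-- The vertices of `𝔾_S` over `v` (the `Π_v`-orbits of `S_v`) inject into the vertices of `𝔾_S`; so they are
finitely many if the latter are. [cite: MochizukiSemiAnbd2006, Def 3.5(i) p.37] -/
theorem finite_orbits_SV_of_finite_vertex [Finite S.coveringSemiGraph.Vertex] (v : 𝒢.graph.Vertex) :
    Finite (BTemp.Orbits (S.SV v)) :=
  Finite.of_injective (fun ω => (⟨v, ω⟩ : S.coveringSemiGraph.Vertex)) fun _ _ h => eq_of_heq (Sigma.mk.inj h).2

/-- The edges of `𝔾_S` over `e` (the `Π_e`-orbits of `S_e`) inject into the edges of `𝔾_S`.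
[cite: MochizukiSemiAnbd2006, Def 3.5(i) p.37] -/
theorem finite_orbits_SE_of_finite_edge [Finite S.coveringSemiGraph.Edge] (e : 𝒢.graph.Edge) :
    Finite (BTemp.Orbits (S.SE e)) :=
  Finite.of_injective (fun ω => (⟨e, ω⟩ : S.coveringSemiGraph.Edge)) fun _ _ h => eq_of_heq (Sigma.mk.inj h).2

/-- **Over a connected `𝒢` with a vertex, an object of `B^cov(G)` whose covering semi-graph has finitely many
vertices is FINITE**: one vertex fibre `S_v` has finitely many `Π_v`-orbits, hence (compact `Π_v`, open
stabilisers) finitely many points, and finiteness spreads along the gluings (`CovObj.isFinite_of_finite_SV`).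
[cite: MochizukiSemiAnbd2006, §3 p.37] -/
theorem isFinite_of_finite_vertex_coveringGraph (hconn : 𝒢.graph.IsConnected) (hV : 𝒢.HasVertex)
    [Finite S.coveringSemiGraph.Vertex] : S.IsFinite := by
  obtain ⟨v⟩ := hV
  haveI := S.finite_orbits_SV_of_finite_vertex v
  exact CovObj.isFinite_of_finite_SV hconn S v (BTemp.finite_of_finite_orbits (S.SV v))

/-- **A finite object over a `𝒢` with finitely many vertices has a covering semi-graph with finitely many
vertices.** [cite: MochizukiSemiAnbd2006, Def 3.5(i) p.37] -/
theorem finite_vertex_coveringGraph [Finite 𝒢.graph.Vertex] (hS : S.IsFinite) :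
    Finite S.coveringSemiGraph.Vertex := by
  haveI : ∀ v, Finite (BTemp.Orbits (S.SV v)) := fun v =>
    haveI := hS.finite_V v; Finite.of_surjective _ (Quot.mk_surjective (r := _))
  infer_instance

/-- **A finite object over a `𝒢` with finitely many edges has a covering semi-graph with finitely many edges.**
[cite: MochizukiSemiAnbd2006, Def 3.5(i) p.37] -/
theorem finite_edge_coveringGraph [Finite 𝒢.graph.Edge] (hS : S.IsFinite) :
    Finite S.coveringSemiGraph.Edge := by
  haveI : ∀ e, Finite (BTemp.Orbits (S.SE e)) := fun e =>
    haveI := hS.finite_E e; Finite.of_surjective _ (Quot.mk_surjective (r := _))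
  infer_instance

end CovObj

end ProfiniteSemiGraph

/-! ### The tower: finite fibres -/

namespace SpecialFibreTower

variable {𝒢 : ProfiniteSemiGraph.{u}}

/-- **The fibres of the Ex. 3.10 tower over `π₁^temp(𝒢)` of a FINITE coherent Thm-3.7 semi-graph of anabelioids are
finite coverings with finitely many vertices and finitely many edges**: the tower of
`exists_of_coverings_finite_vertex` (levels `N`, fibres `𝒢_{S_i}`, admissible kernels `1`) with, for every `i`,
`S_i` a FINITE connected tempered object and `Finite (vertices of 𝔾_i)`, `Finite (edges of 𝔾_i)`.
[cite: MochizukiSemiAnbd2006, Ex 3.10 p.44] -/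
theorem exists_of_coverings_finite [Finite 𝒢.graph.Vertex] [Finite 𝒢.graph.Edge]
    (h37 : 𝒢.Thm37Hypotheses) (hcoh : 𝒢.IsCoherent) (c : TemperedPiChart 𝒢) (N : ℕ → Subgroup c.G)
    (hanti : Antitone N) (hopen : ∀ i, IsOpen (N i : Set c.G))
    (hchar : ∀ (i) (φ : c.G ≃ₜ* c.G), (N i).map φ.toMulEquiv.toMonoidHom = N i)
    (hnormal : ∀ i, (N i).Normal) (hfi : ∀ i, (N i).FiniteIndex) (hexh : ∀ g : c.G, (∀ i, g ∈ N i) → g = 1) :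
    ∃ T : SpecialFibreTower c.G, T.N = N ∧ (∀ i, T.admKer i = ⊥) ∧
      ∀ i, (∃ (S : CovObj 𝒢) (hS : S.IsTempered), T.Gc i = S.coveringGraph ∧
        IsConnectedObj (⟨S, hS⟩ : BTempCat 𝒢) ∧ S.IsFinite) ∧
        Finite (T.Gc i).graph.Vertex ∧ Finite (T.Gc i).graph.Edge := by
  obtain ⟨T, hTN, hadm, hfib⟩ := exists_of_coverings_finite_vertex h37 hcoh c N hanti hopen hchar hnormal hfi hexh
  refine ⟨T, hTN, hadm, fun i => ?_⟩
  obtain ⟨⟨S, hS, hGc, hSc⟩, hfinV⟩ := hfib i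
  haveI : Finite S.coveringSemiGraph.Vertex := by rw [hGc] at hfinV; exact hfinV
  have hfin : S.IsFinite := S.isFinite_of_finite_vertex_coveringGraph h37.isConnected h37.hasVertex
  have hE : Finite S.coveringSemiGraph.Edge := S.finite_edge_coveringGraph hfin
  exact ⟨⟨S, hS, hGc, hSc, hfin⟩, hfinV, by rw [hGc]; exact hE⟩

end SpecialFibreTower

end Literature.AnabelianGeometry.SemiGraphs

end
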